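import Literature.MathematicalPhysics.QuantumFieldTheory.QCDPhaseQuenchedReweighting
import Summits.QuantumFields.QCD.Theorems.GluonicCompletion.Negative.Reweighting
import Summits.QuantumFields.QCD.Theorems.PauliWegnerSeaGluonicCompletionDetNonvanishing

/-!
# Crux `GluonicCompletion` (stmt-QuantumFields-9152), line `finite-sign-budget-at-the-scheme-volume` —
# the sign budget at one volume, unconditional in the a.e. non-vanishing of `det D`

Vocabulary: on the torus of side `S`, at coupling `β` and bare masses `m_q`, `det D = (diracMatrix U m_q).det`,
`μ_W = wilsonMeasure`, `⟨·⟩₊ = qcdPhaseQuenchedExpect β S m_q` (the `|det D|`-weighted law), `W = qcdDetPhase`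
(the sign of `det D`), `⟨X⟩_F(U) = fermiIntegral (X U * fermiBoltzmann U m_q) / fermiIntegral (fermiBoltzmann U m_q)`
(Berezin ratio) and `qcdTorusExpect β S m_q X` the honest SIGNED functional.

* `ae_det_ne_zero_of_half_le_ratio`: a sign ratio `‖∫ det D dμ_W‖ / ∫ |det D| dμ_W ≥ ½` (clause (iv) of the
  crux's hypothesis, at that torus) already forces `det D ≠ 0` for `μ_W`-a.e. `U` — it forces one configuration
  with `det ≠ 0` (`Negative.integral_norm_det_pos_of_half_le_ratio`), and then the landed
  `stub_detNonvanishing` (p81466) applies. So the hypothesis `∀ᵐ U, det ≠ 0` carried by every reweighting identity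
  in the tree (`qcdTorusExpect_eq_phaseQuenched`, `Negative.qcdTorusExpect_eq_detRatio`,
  `Negative.signedCorr_decay_at_own_side`, …) is automatic wherever (iv) holds.
* `norm_qcdTorusExpect_sub_phaseQuenched_le` — **the sign budget at one volume**: under (iv) alone,
  `‖⟨X⟩ − ⟨⟨X⟩_F⟩₊‖ ≤ 2 ‖⟨W ⟨X⟩_F⟩₊ − ⟨W⟩₊ ⟨⟨X⟩_F⟩₊‖` for every Grassmann-valued gauge functional `X`:
  honest minus phase-quenched is the sign–observable COVARIANCE divided by `⟨W⟩₊`, and `‖⟨W⟩₊‖ ≥ ½`. This is the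
  registered helper `signBudgetAtOwnSide` of the line's composition `GluonicCompletion_of` (it is where clause
  (iv) is consumed, at the scheme's own side only).
-/

noncomputable section

namespace Summit.QuantumFields.QCD.Theorems.FiniteSignBudgetAtTheSchemeVolume

open MeasureTheory Filter
open Literature.MathematicalPhysics.QuantumFieldTheory Literature.MathematicalPhysics.QuantumLattice
  Literature.Probability.LatticeModels

variable {Nf : ℕ} {S : ℕ} [NeZero S]

/-- **(iv) at one volume gives `det D ≠ 0` almost everywhere there.** If
`½ ≤ ‖∫ det D dμ_W‖ / ∫ |det D| dμ_W` on the torus of side `S`, then `det (diracMatrix U m_q) ≠ 0` for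
`μ_W`-a.e. `U`: the ratio would be the junk `0 < ½` if `det D ≡ 0`, so some `U₀` has `det ≠ 0`, and the Wilson
determinant, once not identically zero, vanishes only on a `μ_W`-null set (`stub_detNonvanishing`). [folklore] -/
theorem ae_det_ne_zero_of_half_le_ratio (β : ℝ) (mq : Fin Nf → ℝ)
    (h : (1 / 2 : ℝ) ≤ ‖∫ U, (diracMatrix U mq).det ∂(wilsonMeasure (d := 4) (L := S) (fundamentalRep (Fin 3)) β)‖ /
      ∫ U, ‖(diracMatrix U mq).det‖ ∂(wilsonMeasure (d := 4) (L := S) (fundamentalRep (Fin 3)) β)) :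
    ∀ᵐ U ∂(wilsonMeasure (d := 4) (L := S) (fundamentalRep (Fin 3)) β), (diracMatrix U mq).det ≠ 0 := by
  refine stub_detNonvanishing Nf S β mq ?_
  by_contra hall
  simp only [not_exists, not_not] at hall
  have hZ := GluonicCompletion.Negative.integral_norm_det_pos_of_half_le_ratio (S := S) β mq h
  simp [hall] at hZ

/-- **The sign budget at one volume.** On a torus of side `S`, if `‖∫ det D dμ_W‖ ≥ ½ ∫ |det D| dμ_W`
(clause (iv), available at the scheme's OWN side only), then for every Grassmann-valued gauge functional `X`
with Berezin ratio `R = ⟨X⟩_F`: `‖qcdTorusExpect β S m_q X − ⟨R⟩₊‖ ≤ 2 ‖⟨W R⟩₊ − ⟨W⟩₊⟨R⟩₊‖`. Proof: a.e.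
`det ≠ 0` (`ae_det_ne_zero_of_half_le_ratio`) licenses the reweighting identity `⟨X⟩ = ⟨W R⟩₊/⟨W⟩₊`
(`qcdTorusExpect_eq_phaseQuenched`), so `⟨X⟩ − ⟨R⟩₊ = (⟨W R⟩₊ − ⟨W⟩₊⟨R⟩₊)/⟨W⟩₊`, and
`‖⟨W⟩₊‖ = ‖∫ det‖/∫|det| ≥ ½` (`norm_qcdPhaseQuenchedExpect_qcdDetPhase`). No exponentially small partition-function
ratio appears; what remains is additive sign–observable decorrelation. [folklore] -/
theorem norm_qcdTorusExpect_sub_phaseQuenched_le (β : ℝ) (mq : Fin Nf → ℝ)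
    (X : GaugeConfig 4 S SU3 → FermiAlg Nf S)
    (hIV : (1 / 2 : ℝ) ≤ ‖∫ U, (diracMatrix U mq).det ∂(wilsonMeasure (d := 4) (L := S) (fundamentalRep (Fin 3)) β)‖ /
      ∫ U, ‖(diracMatrix U mq).det‖ ∂(wilsonMeasure (d := 4) (L := S) (fundamentalRep (Fin 3)) β)) :
    ‖qcdTorusExpect β S mq X -
        qcdPhaseQuenchedExpect β S mq (fun U =>
          fermiIntegral (X U * fermiBoltzmann U mq) / fermiIntegral (fermiBoltzmann U mq))‖ ≤
      2 * ‖qcdPhaseQuenchedExpect β S mq (fun U => qcdDetPhase U mq *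
              (fermiIntegral (X U * fermiBoltzmann U mq) / fermiIntegral (fermiBoltzmann U mq))) -
            qcdPhaseQuenchedExpect β S mq (fun U => qcdDetPhase U mq) *
              qcdPhaseQuenchedExpect β S mq (fun U =>
                fermiIntegral (X U * fermiBoltzmann U mq) / fermiIntegral (fermiBoltzmann U mq))‖ := by
  rw [qcdTorusExpect_eq_phaseQuenched β mq X (ae_det_ne_zero_of_half_le_ratio β mq hIV)]
  set A := qcdPhaseQuenchedExpect β S mq (fun U => qcdDetPhase U mq *
    (fermiIntegral (X U * fermiBoltzmann U mq) / fermiIntegral (fermiBoltzmann U mq))) with hA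
  set w := qcdPhaseQuenchedExpect β S mq (fun U => qcdDetPhase U mq) with hw
  set r := qcdPhaseQuenchedExpect β S mq (fun U =>
    fermiIntegral (X U * fermiBoltzmann U mq) / fermiIntegral (fermiBoltzmann U mq)) with hr
  have hwn : (1 / 2 : ℝ) ≤ ‖w‖ := by rw [hw, norm_qcdPhaseQuenchedExpect_qcdDetPhase]; exact hIV
  have hw0 : w ≠ 0 := fun h0 => by rw [h0, norm_zero] at hwn; norm_num at hwn
  have key : (A - w * r) / w = A / w - r := by rw [sub_div, mul_div_cancel_left₀ r hw0]
  rw [← key, norm_div, div_le_iff₀ (norm_pos_iff.2 hw0)]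
  nlinarith [norm_nonneg (A - w * r), hwn]

/-- **Registered helper `signBudgetAtOwnSide`** (verbatim the registered signature): the sign budget at one
volume in closed form — for all `N_f`, sides `S`, couplings `β`, bare masses `m_q` and Grassmann-valued `X`,
clause (iv) at that torus bounds `‖honest − phase-quenched‖` by twice the sign–observable covariance.
Immediate from `norm_qcdTorusExpect_sub_phaseQuenched_le`. [folklore] -/
theorem signBudgetAtOwnSide :
    open MeasureTheory Literature.MathematicalPhysics.QuantumFieldTheory Literature.MathematicalPhysics.QuantumLattice in ∀ (Nf S : ℕ) [NeZero S] (β : ℝ) (mq : Fin Nf → ℝ) (X : GaugeConfig 4 S SU3 → FermiAlg Nf S), (1 / 2 : ℝ) ≤ ‖∫ U : GaugeConfig 4 S SU3, (diracMatrix U mq).det ∂(wilsonMeasure (fundamentalRep (Fin 3)) β)‖ / (∫ U : GaugeConfig 4 S SU3, ‖(diracMatrix U mq).det‖ ∂(wilsonMeasure (fundamentalRep (Fin 3)) β)) → ‖qcdTorusExpect β S mq X - qcdPhaseQuenchedExpect β S mq (fun U => fermiIntegral (X U * fermiBoltzmann U mq) / fermiIntegral (fermiBoltzmann U mq))‖ ≤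 2 * ‖qcdPhaseQuenchedExpect β S mq (fun U => qcdDetPhase U mq * (fermiIntegral (X U * fermiBoltzmann U mq) / fermiIntegral (fermiBoltzmann U mq))) - qcdPhaseQuenchedExpect β S mq (fun U => qcdDetPhase U mq) * qcdPhaseQuenchedExpect β S mq (fun U => fermiIntegral (X U * fermiBoltzmann U mq) / fermiIntegral (fermiBoltzmann U mq))‖ :=
  fun _ _ _ β mq X hIV => norm_qcdTorusExpect_sub_phaseQuenched_le β mq X hIV

end Summit.QuantumFields.QCD.Theorems.FiniteSignBudgetAtTheSchemeVolume

end
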